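import Summits.HodgeConjecture.HodgeConjecture.Theorems.Ring2AbelianAllAndreFibreClassInvariantDuality
import HarnessLib

/-!
# Ring 2 · sub-cell AbelianAll (ALL ABELIAN VARIETIES), André axis, part XIV-h — divisoriality of the invariant
# `H²` from its HODGE TYPE: if the rational classes of `j_{t₀}^* H²(𝒳)` are of type `(1,1)` on the fibre then (N₂)(t₀)
# holds (semisimplicity + Lefschetz (1,1), both tree theorems); hence (β′_f) for every compact pencil of abelian
# surfaces or threefolds with `(1,1)`-invariant `H²` at one fibre

HONEST FRAMING (page 1, verbatim): **research route, not a corollary; conditional on HC_CM plus one named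
minimal statement.** Cell line: research route conditional on HC_CM; not a corollary; Q11.4-sentence-2
already refuted in dim ≥ 3. Nothing in this file proves a case of the Hodge conjecture for an abelian variety.
`HC_CM` = `Theses.RankFourFaces.CMAbelianHodge` (a BINDER), item `Theses.RankFourFaces.CMToAbelian` (stmt-16267)
OPEN and not closed here. Seat `pub-hodge-ring2-ab-andre-2`, gen 6; owed item (o16) of RING2-MAP §AbelianAll
AA2.44/AA2.47 — DONE.

## What is proved (theorems only; no definition, no named fact, no sorry)

* **`divisorSpannedInvariantHTwoAt_of_hodgeType_one_one`** — for a compact pencil `f : 𝒳 ⟶ S` of abelian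
  `d`-folds and a point `t₀`: if `j_{t₀}^* W` is of Hodge type `(1,1)` on `𝒳_{t₀}` for every RATIONAL class
  `W ∈ H²(𝒳(ℂ); ℂ)` (i.e. the invariant sub-Hodge structure `I₂(t₀)` has no `(2,0)`-part), then
  `DivisorSpannedInvariantHTwoAt hf t₀` (part XIV-f's (N₂)(t₀)). Proof: part X-a's Hodge-theoretic pseudo-inverse
  `T` of `j_{t₀}^*` (rational, type-preserving, `j^* T j^* = j^*`; semisimplicity of polarisable Hodge structures,
  Voisin 2025 Prop. 2.11) sends `j^* W` to a rational `(1,1)`-class `D` of `𝒳` with `j^* D = j^* W`, algebraic by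
  Lefschetz `(1,1)` (`lefschetzOneOne_rational_holds`); rational classes span `H²`.
* **`fibreClassLefschetzOn_of_hodgeType_one_one_of_le_three`** — (β′_f) `FibreClassLefschetzOn hf` for every compact
  pencil of abelian surfaces or threefolds (`d ≤ 3`) with `(1,1)`-invariant `H²` at one fibre (parts XIV-c/d/g);
  `invariantCyclesHoldFor_of_hodgeType_one_one_of_le_three` (Abdulali's (1.1) for them, part VIII's engine).
* `algebraicInvariantClassesAt_of_hodgeType_of_hodgeClassesAlgebraic` — the general degree: (N_p)(t₀) ⟸ "rational
  classes of `j_{t₀}^* H²ᵖ(𝒳)` are of type `(p,p)`" ∧ "rational `(p,p)`-classes of `𝒳` are algebraic" (`HC^p(𝒳)`, a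
  HYPOTHESIS for `p ≥ 2`).

READING (RING2-MAP AA2.49). The hypothesis of the d = 2, 3 theorems is now Hodge-theoretic and on ONE fibre: "no
rational invariant class of `H²(𝒳_{t₀})` has a `(2,0)`-component". For a pencil of abelian surfaces this fails
exactly when `Λ² H^{1,0}(𝒳_t)` has a flat line, i.e. (Torelli) when the pencil is ISOTRIVIAL — so in print the d = 2
theorem covers every non-isotrivial compact pencil of abelian surfaces (the isotriviality ⟹ flat-line step is not
on the carriers). PRINT STATUS as in part XIV-f: d = 2 print-implied by Tankeev 2011 (`B` for threefolds with
κ < 3); d = 3 compact pencils undetermined pending Tankeev 2003 (acq-02656).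

References: VoisinHodgeI2002 (§7.3, §11.3 Thm. 11.30, Lemma 11.41); Voisin2025 (Prop. 2.11, Lemma 2.9);
DeligneHodgeII1971 (4.1.1, 4.2.6); Abdulali1994FamiliesAV (Conj. 5.3, Thm. 5.5 p. 1130).
-/

noncomputable section

set_option linter.dupNamespace false

namespace Summit.HodgeConjecture.HodgeConjecture.Ring2.AbelianAll

open CategoryTheory AlgebraicGeometry MonoidalCategory CartesianMonoidalCategory
open Literature.AlgebraicGeometry Literature.AlgebraicGeometry.Motives
open Literature.AlgebraicGeometry.HodgeTheory
open Literature.AlgebraicTopology.SingularHomology (singularCohomology)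
open Literature.AlgebraicGeometry.Abdulali1994 (InvariantCyclesHoldFor)

variable {𝒳 S : SchemeOver ℂ}

/-! ## §1 Divisoriality from the Hodge type of the invariant classes: (N₂)(t₀) ⟸ "`I₂(t₀)` is of type `(1,1)`" -/

/-- **(N₂ f)(t₀) from Hodge theory: if every rational class of `j_{t₀}^* H²(𝒳)` is of type `(1,1)` on the fibre,
the invariant `H²` is divisor-spanned.** For a rational `W`, a Hodge-theoretic pseudo-inverse `T` of
`j_{t₀}^* : H²(𝒳) → H²(𝒳_{t₀})` (part X-a `exists_typeShift_pseudoInverse`: rational, type-preserving,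
`j^* T j^* = j^*` — semisimplicity of polarisable Hodge structures) gives the rational `(1,1)`-class `D = T(j^* W)` on
`𝒳` with `j^* D = j^* W`, algebraic by Lefschetz `(1,1)` (`lefschetzOneOne_rational_holds`); rational classes span
`H²(𝒳(ℂ); ℂ)`. The hypothesis says "the invariant sub-Hodge structure `I₂(t₀)` has no `(2,0)`-part" — in print
automatic for NON-ISOTRIVIAL pencils of abelian surfaces (a flat holomorphic 2-form forces a constant period map)
and false for constant pencils. No Hodge-conjecture input beyond Lefschetz `(1,1)` (a theorem).
[cite: VoisinHodgeI2002, §11.3 Thm. 11.30 and §7.3] [cite: Voisin2025, Prop. 2.11 and Lemma 2.9]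
[cite: DeligneHodgeII1971, Thm. 4.1.1 and 4.2.6] -/
theorem divisorSpannedInvariantHTwoAt_of_hodgeType_one_one {d : ℕ} {f : 𝒳 ⟶ S} (hf : IsCompactAbelianPencil f d)
    (t₀ : ComplexPoints S)
    (h11 : ∀ W : complexBetti 𝒳 (2 * 1), IsRationalClass W →
      IsOfHodgeType d (fiberOver f t₀) (2 * 1) 1 1 (complexBetti.map (fiberι f t₀) (2 * 1) W)) :
    DivisorSpannedInvariantHTwoAt hf t₀ := by
  have h𝒳 := hf.isSmoothProjective_total
  have hXt := hf.isSmoothProjective_fiberOver t₀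
  set j : complexBetti 𝒳 (2 * 1) →ₗ[ℂ] complexBetti (fiberOver f t₀) (2 * 1) :=
    (complexBetti.map (fiberι f t₀) (2 * 1)).hom with hj
  have hjapply : ∀ W, j W = complexBetti.map (fiberι f t₀) (2 * 1) W := fun _ ↦ rfl
  -- Hodge-theoretic pseudo-inverse of `j^*` (no type shift)
  obtain ⟨T, hTrat, hTtype, -, hTL⟩ := exists_typeShift_pseudoInverse h𝒳 hXt (a := 2 * 1) (b := 2 * 1) (r := 0)
    (by omega) j (fun c hc ↦ hc.pullback _)
    (fun p q hpq c hc ↦ by simpa using hc.map_of_isSmoothProjective hXt h𝒳 (fiberι f t₀))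
  -- the classes admitting a divisor with the same restriction form a subspace containing the rational classes
  let M : Submodule ℂ (complexBetti 𝒳 (2 * 1)) :=
    { carrier := {W | ∃ D ∈ algebraicClasses 𝒳 1,
        complexBetti.map (fiberι f t₀) (2 * 1) D = complexBetti.map (fiberι f t₀) (2 * 1) W}
      zero_mem' := ⟨0, Submodule.zero_mem _, rfl⟩
      add_mem' := by
        rintro W₁ W₂ ⟨D₁, hD₁, h₁⟩ ⟨D₂, hD₂, h₂⟩
        exact ⟨D₁ + D₂, Submodule.add_mem _ hD₁ hD₂, by rw [map_add, map_add, h₁, h₂]⟩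
      smul_mem' := by
        rintro c W ⟨D, hD, h⟩
        exact ⟨c • D, Submodule.smul_mem _ c hD, by rw [map_smul, map_smul, h]⟩ }
  have hrat : ∀ W : complexBetti 𝒳 (2 * 1), IsRationalClass W → W ∈ M := fun W hW ↦ by
    refine ⟨T (j W), lefschetzOneOne_rational_holds h𝒳 _ (hTrat _ (hW.pullback _)) ?_, ?_⟩
    · exact hTtype 1 1 (by omega) _ (h11 W hW) 1 1 (by omega) (by omega)
    · rw [← hjapply, ← hjapply, hTL]
  have hM : M = ⊤ := by
    rw [eq_top_iff, ← span_isRationalClass_eq_top_of_isSmoothProjective_holds (d + 1) 𝒳 h𝒳 (2 * 1)]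
    exact Submodule.span_le.2 fun W hW ↦ hrat W hW
  intro W
  have hW : W ∈ M := hM ▸ Submodule.mem_top
  exact hW

/-- **(β′_f) for compact pencils of abelian SURFACES or THREEFOLDS whose rational invariant `H²`-classes are of
type `(1,1)` at one fibre** (= off the "transcendental invariant 2-class" locus; in particular every non-isotrivial
abelian-surface pencil in print): parts XIV-c/d/g with §1. No Hodge-conjecture input, no named fact.
[cite: Abdulali1994FamiliesAV, Conjecture 5.3 and Theorem 5.5 (p. 1130)] [cite: VoisinHodgeI2002, §11.3 Thm. 11.30] -/
theorem fibreClassLefschetzOn_of_hodgeType_one_one_of_le_three {d : ℕ} {f : 𝒳 ⟶ S} (hf : IsCompactAbelianPencil f d)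
    (hd : d ≤ 3) (t₀ : ComplexPoints S)
    (h11 : ∀ W : complexBetti 𝒳 (2 * 1), IsRationalClass W →
      IsOfHodgeType d (fiberOver f t₀) (2 * 1) 1 1 (complexBetti.map (fiberι f t₀) (2 * 1) W)) :
    FibreClassLefschetzOn hf :=
  fibreClassLefschetzOn_of_divisorSpanned_of_le_three hf hd t₀ (divisorSpannedInvariantHTwoAt_of_hodgeType_one_one hf t₀ h11)

/-- The same by name for the graded nodes: on a compact pencil of abelian surfaces or threefolds with
`(1,1)`-invariant `H²`, Abdulali's invariant-cycles statement holds (part VIII's engine). [cite: Abdulali1994FamiliesAV, Theorem 5.5 (p. 1130)] -/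
theorem invariantCyclesHoldFor_of_hodgeType_one_one_of_le_three {d : ℕ} {f : 𝒳 ⟶ S}
    (hf : IsCompactAbelianPencil f d) (hd : d ≤ 3) (t₀ : ComplexPoints S)
    (h11 : ∀ W : complexBetti 𝒳 (2 * 1), IsRationalClass W →
      IsOfHodgeType d (fiberOver f t₀) (2 * 1) 1 1 (complexBetti.map (fiberι f t₀) (2 * 1) W)) :
    InvariantCyclesHoldFor f d :=
  invariantCyclesHoldFor_of_fibreClassLefschetzOn hf (fibreClassLefschetzOn_of_hodgeType_one_one_of_le_three hf hd t₀ h11)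

/-- **The general degree with the Hodge conjecture for the TOTAL SPACE in ONE codimension**: if every rational
class of `j_{t₀}^* H²ᵖ(𝒳)` is of type `(p,p)` on the fibre and the rational `(p,p)`-classes of `𝒳` are algebraic
(`HC^p(𝒳)`, a hypothesis; a theorem for `p ≤ 1`), then (N_p)(t₀). Same proof as §1's first theorem.
[cite: Voisin2025, Prop. 2.11 and Lemma 2.9] [cite: VoisinHodgeI2002, §11.3.3 Lemma 11.41] -/
theorem algebraicInvariantClassesAt_of_hodgeType_of_hodgeClassesAlgebraic {d : ℕ} {f : 𝒳 ⟶ S}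
    (hf : IsCompactAbelianPencil f d) (t₀ : ComplexPoints S) (p : ℕ)
    (hpp : ∀ W : complexBetti 𝒳 (2 * p), IsRationalClass W →
      IsOfHodgeType d (fiberOver f t₀) (2 * p) p p (complexBetti.map (fiberι f t₀) (2 * p) W))
    (hHC : ∀ c : complexBetti 𝒳 (2 * p), IsRationalClass c → IsOfHodgeType (d + 1) 𝒳 (2 * p) p p c →
      c ∈ algebraicClasses 𝒳 p) :
    AlgebraicInvariantClassesAt hf t₀ p := by
  have h𝒳 := hf.isSmoothProjective_total
  have hXt := hf.isSmoothProjective_fiberOver t₀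
  set j : complexBetti 𝒳 (2 * p) →ₗ[ℂ] complexBetti (fiberOver f t₀) (2 * p) :=
    (complexBetti.map (fiberι f t₀) (2 * p)).hom with hj
  have hjapply : ∀ W, j W = complexBetti.map (fiberι f t₀) (2 * p) W := fun _ ↦ rfl
  obtain ⟨T, hTrat, hTtype, -, hTL⟩ := exists_typeShift_pseudoInverse h𝒳 hXt (a := 2 * p) (b := 2 * p) (r := 0)
    (by omega) j (fun c hc ↦ hc.pullback _)
    (fun p' q' hpq c hc ↦ by simpa using hc.map_of_isSmoothProjective hXt h𝒳 (fiberι f t₀))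
  let M : Submodule ℂ (complexBetti 𝒳 (2 * p)) :=
    { carrier := {W | ∃ D ∈ algebraicClasses 𝒳 p,
        complexBetti.map (fiberι f t₀) (2 * p) D = complexBetti.map (fiberι f t₀) (2 * p) W}
      zero_mem' := ⟨0, Submodule.zero_mem _, rfl⟩
      add_mem' := by
        rintro W₁ W₂ ⟨D₁, hD₁, h₁⟩ ⟨D₂, hD₂, h₂⟩
        exact ⟨D₁ + D₂, Submodule.add_mem _ hD₁ hD₂, by rw [map_add, map_add, h₁, h₂]⟩
      smul_mem' := by
        rintro c W ⟨D, hD, h⟩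
        exact ⟨c • D, Submodule.smul_mem _ c hD, by rw [map_smul, map_smul, h]⟩ }
  have hrat : ∀ W : complexBetti 𝒳 (2 * p), IsRationalClass W → W ∈ M := fun W hW ↦ by
    refine ⟨T (j W), hHC _ (hTrat _ (hW.pullback _)) ?_, ?_⟩
    · exact hTtype p p (by omega) _ (hpp W hW) p p (by omega) (by omega)
    · rw [← hjapply, ← hjapply, hTL]
  have hM : M = ⊤ := by
    rw [eq_top_iff, ← span_isRationalClass_eq_top_of_isSmoothProjective_holds (d + 1) 𝒳 h𝒳 (2 * p)]
    exact Submodule.span_le.2 fun W hW ↦ hrat W hW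
  intro W
  have hW : W ∈ M := hM ▸ Submodule.mem_top
  exact hW

end Summit.HodgeConjecture.HodgeConjecture.Ring2.AbelianAll

end
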